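import Summits.PneNP.PneNP.Theorems.PhaseTwinsConstantFactorTwinsEverywhereIndep

/-!
# Route PhaseTwins, support `ConstantFactorTwinsEverywhere` (stmt-PneNP-2726): the signed average does not vanish

Continuing `PhaseTwinsConstantFactorTwinsEverywhereIndep`: for a base graph `G` on `Fin v` without
isolated vertices and `λ > 0`,
`Σ_τ sgn(τ) · Z(CFI(G, T_τ), λ) ≠ 0` (`signedSum_ne_zero`). By `signedSum_eq` the left side is
`Σ_I weight λ I`, `weight λ I = [gadgetOK I] λ^{|I|} Π_d δ(d, I)`, and:
* configurations that are NOT FULL (some gadget carries no middle vertex of `I`) cancel in pairs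
  under the flip at the pivot dart of the least free gadget (`sum_weight_not_full`, a
  `Finset.sum_involution`);
* every FULL configuration with non-zero weight is transversal at every dart, the occupied bits
  around a gadget `u` are `0` exactly on the (even!) index set of its middle vertex, and so
  `Π_d δ(d, I) = (-1)^{#edges}` (`prod_delta_of_full`): all full configurations contribute with the
  same sign, and the reference configuration `Istar` (all `m(u, ∅)`, all `a`-links) contributes
  `λ^{|I⋆|} (-1)^{#edges} ≠ 0`.
-/

namespace Summit.PneNP.PneNP.PhaseTwins.ConstantFactorTwins

-- `Summit.PneNP.PneNP.…` (summit = sub-problem name) trips the duplicate-namespace linter on every declaration.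
set_option linter.dupNamespace false

open Finset
open Literature.ModelTheory.FiniteModelTheory
open Literature.Probability.LatticeModels (independencePolynomial)

noncomputable section

open scoped Classical

variable {v : ℕ} {G : SimpleGraph (Fin v)} [DecidableRel G.Adj]

/-! ### Full configurations: the sign of the product of the `δ` -/

omit [DecidableRel G.Adj] in
/-- Boolean bookkeeping: complementary decisions. -/
theorem iff_not_of_decide_eq_not {P Q : Prop} [Decidable P] [Decidable Q] (h : decide P = !decide Q) :
    P ↔ ¬ Q := by
  by_cases hP : P <;> by_cases hQ : Q <;> simp [hP, hQ] at h ⊢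

/-- Non-vanishing of `δ(d, I)` forces transversality at both darts of the edge. -/
theorem transversal_of_delta_ne {I : Finset (CFIVertex G)} {d : CFIDart G} (h : delta I d ≠ 0) :
    (linkV (d, true) ∈ I ↔ linkV (d, false) ∉ I) ∧
      (linkV (rev d, true) ∈ I ↔ linkV (rev d, false) ∉ I) := by
  have tab : ∀ a b c d : Bool, dTable a b c d ≠ 0 → (a = !b) ∧ (c = !d) := by decide
  unfold delta at h
  obtain ⟨h1, h2⟩ := tab _ _ _ _ (by exact_mod_cast h)
  exact ⟨iff_not_of_decide_eq_not h1, iff_not_of_decide_eq_not h2⟩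

/-- Non-vanishing of all `δ(d, I)` over oriented darts forces transversality at every dart. -/
theorem transversal {I : Finset (CFIVertex G)} (hδ : ∀ o : ODart G, delta I o.1 ≠ 0) (d : CFIDart G) :
    linkV (d, true) ∈ I ↔ linkV (d, false) ∉ I := by
  rcases orient_eq_or d with h | h
  · have := (transversal_of_delta_ne (hδ (orient d))).1
    rwa [h] at this
  · have := (transversal_of_delta_ne (hδ (orient d))).2
    rwa [h, rev_rev] at this

/-- The occupied bit read at a dart. -/
theorem bitFn_dart (I : Finset (CFIVertex G)) (d : CFIDart G) :
    bitFn I d.1.1 d.1.2 = decide (linkV (d, true) ∈ I) := by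
  obtain ⟨⟨u, w⟩, h⟩ := d
  simp [bitFn, h]

/-- On a transversal configuration, `δ(d, I) = -ε(bit d) ε(bit (rev d))`. -/
theorem delta_eq_of_transversal {I : Finset (CFIVertex G)} (hδ : ∀ o : ODart G, delta I o.1 ≠ 0)
    (d : CFIDart G) : delta I d = -(eps (bitFn I d.1.1 d.1.2) * eps (bitFn I d.1.2 d.1.1)) := by
  have tab : ∀ a c : Bool, (dTable a (!a) c (!c) : ℝ) = -(eps a * eps c) := by
    intro a c; cases a <;> cases c <;> simp [dTable, eTable, eps]
  have h1 : decide (linkV (d, false) ∈ I) = !decide (linkV (d, true) ∈ I) := by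
    have := transversal hδ d
    by_cases hT : linkV (d, true) ∈ I <;> by_cases hF : linkV (d, false) ∈ I <;> simp_all
  have h2 : decide (linkV (rev d, false) ∈ I) = !decide (linkV (rev d, true) ∈ I) := by
    have := transversal hδ (rev d)
    by_cases hT : linkV (rev d, true) ∈ I <;> by_cases hF : linkV (rev d, false) ∈ I <;> simp_all
  rw [delta, h1, h2, tab, bitFn_dart, show bitFn I d.1.2 d.1.1 = bitFn I (rev d).1.1 (rev d).1.2 from rfl,
    bitFn_dart]

/-- The product of `ε(bit)` over the two orientations is the product over all darts. -/
theorem prod_eps_orient (I : Finset (CFIVertex G)) :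
    (∏ o : ODart G, eps (bitFn I o.1.1.1 o.1.1.2)) * ∏ o : ODart G, eps (bitFn I o.1.1.2 o.1.1.1) =
      ∏ d : CFIDart G, eps (bitFn I d.1.1 d.1.2) := by
  have h := Fintype.prod_sum_type (fun x : ODart G ⊕ ODart G =>
    Sum.elim (fun o => eps (bitFn I o.1.1.1 o.1.1.2)) (fun o => eps (bitFn I o.1.1.2 o.1.1.1)) x)
  simp only [Sum.elim_inl, Sum.elim_inr] at h
  rw [← h]
  refine Fintype.prod_equiv dartSumEquiv _ _ ?_
  rintro (o | o) <;> rfl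

/-- The product of `ε(bit)` over all darts, gadget by gadget. -/
theorem prod_eps_darts (I : Finset (CFIVertex G)) :
    ∏ d : CFIDart G, eps (bitFn I d.1.1 d.1.2) =
      ∏ u : Fin v, ∏ w ∈ G.neighborFinset u, eps (bitFn I u w) := by
  rw [Fintype.prod_equiv (Equiv.subtypeProdEquivSigmaSubtype fun u w : Fin v => G.Adj u w)
    (fun d => eps (bitFn I d.1.1 d.1.2)) (fun x => eps (bitFn I x.1 x.2.1)) (by
      rintro ⟨⟨u, w⟩, h⟩; rfl),
    Fintype.prod_sigma]
  refine Finset.prod_congr rfl fun u _ => ?_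
  exact (Finset.prod_subtype (G.neighborFinset u) (fun w => G.mem_neighborFinset u w)
    (fun w => eps (bitFn I u w))).symm

/-- In a full, transversal configuration satisfying the gadget constraint, the occupied bit at
`(u, w)` is `0` exactly on the index set of the middle vertex at `u`. -/
theorem bitFn_eq_false_iff {I : Finset (CFIVertex G)} (hg : I ∈ gadgetOK G)
    (hδ : ∀ o : ODart G, delta I o.1 ≠ 0) {u : Fin v}
    {S : {S : Finset (Fin v) // S ⊆ G.neighborFinset u ∧ Even S.card}} (hS : midV ⟨u, S⟩ ∈ I)
    {w : Fin v} (hw : G.Adj u w) : bitFn I u w = false ↔ w ∈ S.1 := by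
  have ht := transversal hδ ⟨(u, w), hw⟩
  unfold bitFn
  rw [dif_pos hw]
  by_cases hT : linkV (⟨(u, w), hw⟩, true) ∈ I
  · have h1 := hg ⟨u, S⟩ hS ⟨(u, w), hw⟩ true hT
    simp only [true_and, true_iff] at h1
    simp [hT, h1]
  · have hF : linkV (⟨(u, w), hw⟩, false) ∈ I := by
      by_contra hF; exact hT (ht.2 hF)
    have h1 := hg ⟨u, S⟩ hS ⟨(u, w), hw⟩ false hF
    simp only [Bool.false_eq_true, false_iff, true_and, not_not] at h1
    simp [hT, h1]

/-- **The sign of a full configuration**: `Π_d δ(d, I) = (-1)^{#oriented darts}`. -/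
theorem prod_delta_of_full {I : Finset (CFIVertex G)} (hfull : I ∈ full G) (hg : I ∈ gadgetOK G)
    (hδ : ∀ o : ODart G, delta I o.1 ≠ 0) :
    ∏ o : ODart G, delta I o.1 = (-1) ^ Fintype.card (ODart G) := by
  have step1 : ∏ o : ODart G, delta I o.1 =
      ∏ o : ODart G, ((-1) * (eps (bitFn I o.1.1.1 o.1.1.2) * eps (bitFn I o.1.1.2 o.1.1.1))) :=
    Finset.prod_congr rfl fun o _ => by rw [delta_eq_of_transversal hδ o.1, neg_one_mul]
  rw [step1, Finset.prod_mul_distrib, Finset.prod_const, Finset.card_univ, Finset.prod_mul_distrib,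
    prod_eps_orient, prod_eps_darts]
  suffices h : ∀ u : Fin v, ∏ w ∈ G.neighborFinset u, eps (bitFn I u w) = 1 by
    rw [Finset.prod_congr rfl fun u _ => h u, Finset.prod_const_one, mul_one]
  intro u
  obtain ⟨S, hS⟩ := hfull u
  have h1 : ∀ w ∈ G.neighborFinset u, eps (bitFn I u w) = if w ∈ S.1 then -1 else 1 := by
    intro w hw
    rw [SimpleGraph.mem_neighborFinset] at hw
    unfold eps
    by_cases hb : bitFn I u w = true
    · have : w ∉ S.1 := fun hmem => by
        have := (bitFn_eq_false_iff hg hδ hS hw).2 hmem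
        rw [this] at hb; exact Bool.false_ne_true hb
      simp [hb, this]
    · rw [Bool.not_eq_true] at hb
      simp [hb, (bitFn_eq_false_iff hg hδ hS hw).1 hb]
  rw [Finset.prod_congr rfl h1, Finset.prod_ite, Finset.prod_const, Finset.prod_const_one, mul_one,
    Finset.filter_mem_eq_inter, Finset.inter_eq_right.2 S.2.1]
  exact Even.neg_one_pow S.2.2

/-! ### The signed average does not vanish -/

/-- A configuration has a free gadget iff it is not full. -/
theorem freeVerts_nonempty_iff (I : Finset (CFIVertex G)) : (freeVerts I).Nonempty ↔ I ∉ full G := by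
  simp only [freeVerts, mem_full, Finset.filter_nonempty_iff, Finset.mem_univ, true_and, not_forall,
    not_exists]

/-- The flip does not change the free gadgets. -/
theorem freeVerts_flipI (d₀ : CFIDart G) (I : Finset (CFIVertex G)) : freeVerts (flipI d₀ I) = freeVerts I := by
  unfold freeVerts
  simp only [midV_mem_flipI]

/-- The flip preserves fullness. -/
theorem full_flipI_iff (d₀ : CFIDart G) (I : Finset (CFIVertex G)) : flipI d₀ I ∈ full G ↔ I ∈ full G := by
  simp only [mem_full, midV_mem_flipI]

omit [DecidableRel G.Adj] in
/-- `Finset.min'` along an equality of sets. -/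
theorem min'_congr {s t : Finset (Fin v)} (hst : s = t) (hs : s.Nonempty) (ht : t.Nonempty) :
    s.min' hs = t.min' ht := by subst hst; rfl

/-- The pivot depends only on the free gadgets. -/
theorem pivot_congr (hdeg : ∀ u : Fin v, (G.neighborFinset u).Nonempty) {I J : Finset (CFIVertex G)}
    (hIJ : freeVerts I = freeVerts J) (hI : (freeVerts I).Nonempty) (hJ : (freeVerts J).Nonempty) :
    pivot hdeg I hI = pivot hdeg J hJ := by
  unfold pivot
  rw [min'_congr hIJ hI hJ]

/-- The gadget of the pivot carries no middle vertex. -/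
theorem pivot_free (hdeg : ∀ u : Fin v, (G.neighborFinset u).Nonempty) (I : Finset (CFIVertex G))
    (h : (freeVerts I).Nonempty) : ∀ S, midV ⟨(pivot hdeg I h).1.1, S⟩ ∉ I := by
  have := Finset.min'_mem (freeVerts I) h
  unfold freeVerts at this
  intro S
  exact (Finset.mem_filter.1 this).2 S

/-- **Configurations missing a gadget cancel in pairs.** -/
theorem sum_weight_not_full (hdeg : ∀ u : Fin v, (G.neighborFinset u).Nonempty) (lam : ℝ) :
    ∑ I ∈ (univ : Finset (Finset (CFIVertex G))).filter (fun I => I ∉ full G), weight lam I = 0 := by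
  have hne : ∀ I ∈ (univ : Finset (Finset (CFIVertex G))).filter (fun I => I ∉ full G),
      (freeVerts I).Nonempty := fun I hI =>
    (freeVerts_nonempty_iff I).2 (Finset.mem_filter.1 hI).2
  refine Finset.sum_involution (fun I hI => flipI (pivot hdeg I (hne I hI)) I) ?_ ?_ ?_ ?_
  · intro I hI
    unfold weight
    rw [card_flipI, prod_delta_flipI, gadgetOK_flipI (pivot_free hdeg I (hne I hI))]
    ring
  · intro I hI hw
    apply flipI_ne_self
    unfold weight at hw
    intro h0
    rw [h0, mul_zero] at hw
    exact hw rfl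
  · intro I hI
    refine Finset.mem_filter.2 ⟨Finset.mem_univ _, ?_⟩
    rw [full_flipI_iff]
    exact (Finset.mem_filter.1 hI).2
  · intro I hI
    rw [pivot_congr hdeg (freeVerts_flipI _ I)]
    exact flipI_flipI _ I

/-- The middle vertices of `I⋆` are the empty ones. -/
theorem midV_mem_Istar {x : CFIMidIdx G} : midV x ∈ (Istar : Finset (CFIVertex G)) ↔ x.2 = emptyMid G x.1 := by
  unfold Istar
  simp only [Finset.mem_union, Finset.mem_image, Finset.mem_univ, true_and]
  constructor
  · rintro (⟨u, hu⟩ | ⟨d, hd⟩)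
    · rw [midV_inj] at hu
      rw [← hu]
    · exact absurd hd linkV_ne_midV
  · intro h
    refine Or.inl ⟨x.1, ?_⟩
    rw [midV_inj]
    obtain ⟨u, S⟩ := x
    simp only at h
    rw [h]

/-- The links of `I⋆` are the `a`-links. -/
theorem linkV_mem_Istar {d : CFIDart G} {c : Bool} : linkV (d, c) ∈ (Istar : Finset (CFIVertex G)) ↔ c = true := by
  unfold Istar
  simp only [Finset.mem_union, Finset.mem_image, Finset.mem_univ, true_and]
  constructor
  · rintro (⟨u, hu⟩ | ⟨d', hd⟩)
    · exact absurd hu midV_ne_linkV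
    · rw [linkV_inj] at hd
      exact (congrArg Prod.snd hd).symm
  · rintro rfl
    exact Or.inr ⟨d, rfl⟩

/-- `I⋆` is full. -/
theorem full_Istar : (Istar : Finset (CFIVertex G)) ∈ full G := fun u =>
  ⟨emptyMid G u, midV_mem_Istar.2 rfl⟩

/-- `I⋆` satisfies the gadget constraint. -/
theorem gadgetOK_Istar : (Istar : Finset (CFIVertex G)) ∈ gadgetOK G := by
  intro x hx d c hd
  rw [midV_mem_Istar] at hx
  rw [linkV_mem_Istar] at hd
  subst hd
  rintro ⟨-, h⟩
  rw [hx] at h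
  simp at h

/-- Every `δ(d, I⋆)` is `-1`. -/
theorem delta_Istar (d : CFIDart G) : delta (Istar : Finset (CFIVertex G)) d = -1 := by
  unfold delta
  simp only [linkV_mem_Istar, decide_true, Bool.false_eq_true, decide_false]
  simp [dTable, eTable]

/-- The weight of `I⋆`. -/
theorem weight_Istar (lam : ℝ) :
    weight lam (Istar : Finset (CFIVertex G)) =
      lam ^ (Istar : Finset (CFIVertex G)).card * (-1) ^ Fintype.card (ODart G) := by
  unfold weight
  rw [if_pos gadgetOK_Istar, one_mul, Finset.prod_congr rfl fun d _ => delta_Istar d.1, Finset.prod_const,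
    Finset.card_univ]

/-- Every full configuration contributes with the sign `(-1)^{#oriented darts}`. -/
theorem weight_mul_sign_nonneg {lam : ℝ} (hlam : 0 < lam) {I : Finset (CFIVertex G)} (hfull : I ∈ full G) :
    0 ≤ (-1) ^ Fintype.card (ODart G) * weight lam I := by
  unfold weight
  by_cases hg : I ∈ gadgetOK G
  · rw [if_pos hg, one_mul]
    by_cases hδ : ∀ o : ODart G, delta I o.1 ≠ 0
    · rw [prod_delta_of_full hfull hg hδ, mul_comm, mul_assoc, ← pow_add, ← two_mul, pow_mul]
      have : ((-1 : ℝ) ^ 2) = 1 := by norm_num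
      rw [this, one_pow, mul_one]
      positivity
    · push Not at hδ
      obtain ⟨o, ho⟩ := hδ
      rw [Finset.prod_eq_zero (Finset.mem_univ o) ho, mul_zero, mul_zero]
  · rw [if_neg hg, zero_mul, zero_mul, mul_zero]

/-- **The signed average of the partition functions does not vanish** (`λ > 0`, no isolated base vertex). -/
theorem signedSum_ne_zero (hdeg : ∀ u : Fin v, (G.neighborFinset u).Nonempty) {lam : ℝ} (hlam : 0 < lam) :
    ∑ τ : ODart G → Bool, (∏ d, sgn (τ d)) * independencePolynomial (cfiGraph G (twistSet τ)) lam ≠ 0 := by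
  rw [signedSum_eq]
  change ∑ I : Finset (CFIVertex G), weight lam I ≠ 0
  rw [← Finset.sum_filter_add_sum_filter_not univ (· ∈ full G),
    sum_weight_not_full hdeg lam, add_zero]
  intro h0
  have hpos : 0 < ∑ I ∈ univ.filter (· ∈ full G),
      (-1) ^ Fintype.card (ODart G) * weight lam I := by
    apply Finset.sum_pos'
    · intro I hI
      exact weight_mul_sign_nonneg hlam (Finset.mem_filter.1 hI).2
    · refine ⟨Istar, Finset.mem_filter.2 ⟨Finset.mem_univ _, full_Istar⟩, ?_⟩
      rw [weight_Istar, mul_comm, mul_assoc, ← pow_add, ← two_mul, pow_mul]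
      have : ((-1 : ℝ) ^ 2) = 1 := by norm_num
      rw [this, one_pow, mul_one]
      positivity
  rw [← Finset.mul_sum, h0, mul_zero] at hpos
  exact lt_irrefl _ hpos

end

end Summit.PneNP.PneNP.PhaseTwins.ConstantFactorTwins
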